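import Literature.GroupTheory.SpecificGroups.GL2SubgroupContainsSL2
import HarnessLib

/-!
# A subgroup of `GL₂(𝔽_l)` with a non-trivial unipotent element and no invariant line contains `SL₂(𝔽_l)`
# (the coordinate-free form of [GenEll] Lemma 3.1 (iii), as used in [GenEll] Thm. 3.8 and [IUTchIV] Cor. 2.2 (P6))

S. Mochizuki, *Arithmetic elliptic curves in general position*, Math. J. Okayama Univ. **52** (2010),
Lemma 3.1 (iii) p. 14 and the final portion of the proof of Theorem 3.8, p. 20
[cite: MochizukiGenEll2010, Lem 3.1 (iii) p.14]; used verbatim in [IUTchIV] Cor. 2.2, proof of (P6),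
p. 46: "since `E_F` has bad multiplicative reduction at some valuation … (P6) [the image of
`Gal(Q̄/F) → GL₂(𝔽_l)` contains `SL₂(𝔽_l)`] follows formally from (P2), (P4), and [GenEll], Lemma 3.1,
(iii)".  The formal step is: the image `H` contains a non-identity unipotent element (inertia at a prime
of multiplicative reduction with `l ∤` the local height, acting through `(1 *; 0 1)` on the Tate module)
and stabilises no line (no `l`-cyclic subgroup scheme, (P4)); in a basis `(N w, w)`, `N = u − 1`, the
unipotent `u` becomes `α = (1 1; 0 1)` and an element moving the line `⟨N w⟩` is not upper triangular,
so Lemma 3.1 (iii) (`range_toGL_le_of_upperRightHom_one_mem`, file `GL2SubgroupContainsSL2.lean`)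
applies to the conjugate subgroup, and `SL₂` is normal.  This file proves exactly that:

* `range_toGL_le_of_unipotent_of_no_invariant_line` — `H ≤ GL₂(𝔽_l)` (`l` any prime) containing `u`
  with `u ≠ 1`, `(u − 1)² = 0`, and such that for every `v ≠ 0` some `h ∈ H` has `h·v ∉ 𝔽_l·v`,
  contains `SL₂(𝔽_l)`.

Mathlib + the tree only; theorems only; no named facts.
-/

namespace Literature.GroupTheory.SpecificGroups

open Matrix MatrixGroups Matrix.SpecialLinearGroup

variable {l : ℕ} [Fact l.Prime]

/-- Conjugation moves `SL₂`-containment: if the conjugate subgroup `{x | P x P⁻¹ ∈ H}` contains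
`SL₂(𝔽_l)`, so does `H` (`SL₂ ⊴ GL₂`). [cite: MochizukiGenEll2010, Lem 3.1 (iii) p.14] -/
theorem range_toGL_le_of_range_toGL_le_comap_conj {F : Type*} [Field F]
    (H : Subgroup (GL (Fin 2) F)) (P : GL (Fin 2) F)
    (h : (toGL : SL(2, F) →* GL (Fin 2) F).range ≤ H.comap (MulAut.conj P).toMonoidHom) :
    (toGL : SL(2, F) →* GL (Fin 2) F).range ≤ H := by
  rintro _ ⟨t, rfl⟩
  -- `s := P⁻¹ t P` has determinant `1`
  have hdet : Matrix.det ((P⁻¹ * toGL t * P : GL (Fin 2) F) : Matrix (Fin 2) (Fin 2) F) = 1 := by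
    have h1 : Matrix.GeneralLinearGroup.det (P⁻¹ * toGL t * P) = 1 := by
      rw [map_mul, map_mul, coeToGL_det, mul_one, map_inv, inv_mul_cancel]
    have h2 := congrArg (fun u : Fˣ => (u : F)) h1
    simp only [Matrix.GeneralLinearGroup.val_det_apply, Units.val_one] at h2
    exact h2
  set s : SL(2, F) := ⟨((P⁻¹ * toGL t * P : GL (Fin 2) F) : Matrix (Fin 2) (Fin 2) F), hdet⟩ with hs
  have hts : toGL s = P⁻¹ * toGL t * P := Units.ext rfl
  have hmem := h ⟨s, rfl⟩
  rw [Subgroup.mem_comap, MulEquiv.coe_toMonoidHom, MulAut.conj_apply, hts] at hmem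
  simpa [mul_assoc] using hmem

/-- **[GenEll] Lemma 3.1 (iii), coordinate-free form** (the "formal" step of [GenEll] Thm. 3.8, p. 20,
and [IUTchIV] Cor. 2.2 (P6), p. 46): let `l` be a prime and `H ≤ GL₂(𝔽_l)` a subgroup containing a
unipotent element `u ≠ 1` (`(u − 1)² = 0`) and such that no line of `𝔽_l²` is stable under `H`
(for every `v ≠ 0` some `h ∈ H` has `h·v ∉ 𝔽_l·v`). Then `SL₂(𝔽_l) ≤ H`.
[cite: MochizukiGenEll2010, Lem 3.1 (iii) p.14] -/
theorem range_toGL_le_of_unipotent_of_no_invariant_line (H : Subgroup (GL (Fin 2) (ZMod l)))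
    {u : GL (Fin 2) (ZMod l)} (huH : u ∈ H) (hu1 : u ≠ 1)
    (hu2 : ((u : Matrix (Fin 2) (Fin 2) (ZMod l)) - 1) * ((u : Matrix (Fin 2) (Fin 2) (ZMod l)) - 1) = 0)
    (hirr : ∀ v : Fin 2 → ZMod l, v ≠ 0 →
      ∃ h ∈ H, ∀ c : ZMod l, (h : Matrix (Fin 2) (Fin 2) (ZMod l)) *ᵥ v ≠ c • v) :
    (toGL : SL(2, ZMod l) →* GL (Fin 2) (ZMod l)).range ≤ H := by
  -- entries of `N = u - 1`
  set N : Matrix (Fin 2) (Fin 2) (ZMod l) := (u : Matrix (Fin 2) (Fin 2) (ZMod l)) - 1 with hN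
  have hu_eq : (u : Matrix (Fin 2) (Fin 2) (ZMod l)) = 1 + N := by rw [hN]; abel
  -- the four entries of `N² = 0`
  have e00 := congrFun (congrFun hu2 0) 0
  have e01 := congrFun (congrFun hu2 0) 1
  have e10 := congrFun (congrFun hu2 1) 0
  have e11 := congrFun (congrFun hu2 1) 1
  simp only [Matrix.mul_apply, Fin.sum_univ_two, Matrix.zero_apply, Fin.isValue] at e00 e01 e10 e11
  set n00 : ZMod l := N 0 0 with hn00
  set n01 : ZMod l := N 0 1 with hn01
  set n10 : ZMod l := N 1 0 with hn10
  set n11 : ZMod l := N 1 1 with hn11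
  have hNe : N = !![n00, n01; n10, n11] := by rw [hn00, hn01, hn10, hn11]; exact Matrix.eta_fin_two N
  -- `N ≠ 0`
  have hN0 : ¬ (n00 = 0 ∧ n01 = 0 ∧ n10 = 0 ∧ n11 = 0) := by
    rintro ⟨h1, h2, h3, h4⟩
    apply hu1
    apply Matrix.GeneralLinearGroup.ext
    intro i j
    rw [hu_eq, hNe, Units.val_one]
    fin_cases i <;> fin_cases j <;> simp [h1, h2, h3, h4]
  -- a change-of-basis matrix `P = [N w | w]` with `u P = P α`, in the two cases `N₁₀ ≠ 0` / `N₁₀ = 0`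
  obtain ⟨P, hP, hPcol⟩ : ∃ P : GL (Fin 2) (ZMod l),
      u * P = P * GeneralLinearGroup.upperRightHom (1 : ZMod l) ∧
      N *ᵥ (fun i => (P : Matrix (Fin 2) (Fin 2) (ZMod l)) i 0) = 0 := by
    by_cases h10 : n10 = 0
    · -- then `N₀₀ = N₁₁ = 0` and `N₀₁ ≠ 0`; take `w = e₁`
      have h00 : n00 = 0 := by
        have : n00 * n00 = 0 := by rw [h10] at e00; linear_combination e00
        exact mul_self_eq_zero.mp this
      have h11 : n11 = 0 := by
        have : n11 * n11 = 0 := by rw [h10] at e11; linear_combination e11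
        exact mul_self_eq_zero.mp this
      have h01 : n01 ≠ 0 := fun h01 => hN0 ⟨h00, h01, h10, h11⟩
      refine ⟨Matrix.GeneralLinearGroup.mkOfDetNeZero !![n01, 0; 0, 1]
        (by rw [Matrix.det_fin_two_of]; simpa using h01), ?_, ?_⟩
      · apply Matrix.GeneralLinearGroup.ext
        intro i j
        simp only [Matrix.GeneralLinearGroup.coe_mul, hu_eq, Matrix.GeneralLinearGroup.val_mkOfDetNeZero,
          GeneralLinearGroup.upperRightHom_apply, hNe]
        fin_cases i <;> fin_cases j <;> simp [Matrix.mul_apply, Fin.sum_univ_two, h00, h10, h11]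
      · rw [hNe]
        ext i
        fin_cases i <;>
          simp [Matrix.mulVec, dotProduct, Fin.sum_univ_two, Matrix.GeneralLinearGroup.val_mkOfDetNeZero,
            h00, h10]
    · -- take `w = e₀`
      refine ⟨Matrix.GeneralLinearGroup.mkOfDetNeZero !![n00, 1; n10, 0]
        (by rw [Matrix.det_fin_two_of]; simpa using h10), ?_, ?_⟩
      · apply Matrix.GeneralLinearGroup.ext
        intro i j
        simp only [Matrix.GeneralLinearGroup.coe_mul, hu_eq, Matrix.GeneralLinearGroup.val_mkOfDetNeZero,
          GeneralLinearGroup.upperRightHom_apply, hNe]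
        fin_cases i <;> fin_cases j <;> simp [Matrix.mul_apply, Fin.sum_univ_two] <;>
          first
            | ring1
            | linear_combination e00
            | linear_combination e10
      · rw [hNe]
        ext i
        fin_cases i <;>
          simp [Matrix.mulVec, dotProduct, Fin.sum_univ_two, Matrix.GeneralLinearGroup.val_mkOfDetNeZero] <;>
          first
            | ring1
            | linear_combination e00
            | linear_combination e10
  -- the conjugate subgroup `H' = {x | P x P⁻¹ ∈ H}` contains `α` …
  set H' : Subgroup (GL (Fin 2) (ZMod l)) := H.comap (MulAut.conj P).toMonoidHom with hH'
  have hmemH' : ∀ x, x ∈ H' ↔ P * x * P⁻¹ ∈ H := fun x => by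
    rw [hH', Subgroup.mem_comap, MulEquiv.coe_toMonoidHom, MulAut.conj_apply]
  have hα : GeneralLinearGroup.upperRightHom (1 : ZMod l) ∈ H' := by
    rw [hmemH', ← hP, mul_inv_cancel_right]
    exact huH
  -- … and a non-upper-triangular element: conjugate an `h ∈ H` moving the line `⟨P e₀⟩ = ⟨N w⟩`
  set v : Fin 2 → ZMod l := fun i => (P : Matrix (Fin 2) (Fin 2) (ZMod l)) i 0 with hv
  have hv0 : v ≠ 0 := by
    intro hv0
    have hdet : Matrix.det (P : Matrix (Fin 2) (Fin 2) (ZMod l)) = 0 := by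
      rw [Matrix.det_fin_two, show (P : Matrix (Fin 2) (Fin 2) (ZMod l)) 0 0 = v 0 from rfl,
        show (P : Matrix (Fin 2) (Fin 2) (ZMod l)) 1 0 = v 1 from rfl, hv0]
      simp
    exact (Matrix.GeneralLinearGroup.det P).ne_zero (by
      rw [Matrix.GeneralLinearGroup.val_det_apply] at *; exact hdet) |>.elim
  obtain ⟨h, hhH, hh⟩ := hirr v hv0
  have hβ : ∃ g ∈ H', (g : Matrix (Fin 2) (Fin 2) (ZMod l)) 1 0 ≠ 0 := by
    set g : GL (Fin 2) (ZMod l) := P⁻¹ * h * P with hg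
    refine ⟨g, ?_, ?_⟩
    · rw [hmemH', hg]
      simpa [mul_assoc] using hhH
    · intro h10
      -- `g e₀ = c e₀` with `c` the `(0,0)` entry of `g`, hence `h v = c v`
      set c : ZMod l := (g : Matrix (Fin 2) (Fin 2) (ZMod l)) 0 0 with hc
      apply hh c
      have hcol : (g : Matrix (Fin 2) (Fin 2) (ZMod l)) *ᵥ (Pi.single 0 1) = c • Pi.single 0 1 := by
        ext i
        fin_cases i
        · simp [Matrix.mulVec, dotProduct, Fin.sum_univ_two, hc]
        · simpa [Matrix.mulVec, dotProduct, Fin.sum_univ_two] using h10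
      have hPv : (P : Matrix (Fin 2) (Fin 2) (ZMod l)) *ᵥ (Pi.single 0 1) = v := by
        ext i; fin_cases i <;> simp [Matrix.mulVec, dotProduct, Fin.sum_univ_two, hv]
      have hPPinv : (P : Matrix (Fin 2) (Fin 2) (ZMod l)) *
          ((P⁻¹ : GL (Fin 2) (ZMod l)) : Matrix (Fin 2) (Fin 2) (ZMod l)) = 1 := by
        rw [← Matrix.GeneralLinearGroup.coe_mul, mul_inv_cancel, Units.val_one]
      have hPg : (P : Matrix (Fin 2) (Fin 2) (ZMod l)) * (g : Matrix (Fin 2) (Fin 2) (ZMod l)) =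
          (h : Matrix (Fin 2) (Fin 2) (ZMod l)) * (P : Matrix (Fin 2) (Fin 2) (ZMod l)) := by
        rw [hg, Matrix.GeneralLinearGroup.coe_mul, Matrix.GeneralLinearGroup.coe_mul, ← mul_assoc,
          ← mul_assoc, hPPinv, one_mul]
      calc (h : Matrix (Fin 2) (Fin 2) (ZMod l)) *ᵥ v
          = (h : Matrix (Fin 2) (Fin 2) (ZMod l)) *ᵥ ((P : Matrix (Fin 2) (Fin 2) (ZMod l)) *ᵥ
              (Pi.single 0 1)) := by rw [hPv]
        _ = ((P : Matrix (Fin 2) (Fin 2) (ZMod l)) * (g : Matrix (Fin 2) (Fin 2) (ZMod l))) *ᵥ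
              (Pi.single 0 1) := by rw [Matrix.mulVec_mulVec, hPg]
        _ = (P : Matrix (Fin 2) (Fin 2) (ZMod l)) *ᵥ (c • Pi.single 0 1) := by
              rw [← Matrix.mulVec_mulVec, hcol]
        _ = c • v := by rw [Matrix.mulVec_smul, hPv]
  exact range_toGL_le_of_range_toGL_le_comap_conj H P
    (range_toGL_le_of_upperRightHom_one_mem H' hα hβ)

end Literature.GroupTheory.SpecificGroups
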